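import Summits.QuantumAdvantage.AdviceFreeQNC0.StructuredWin
import Summits.QuantumAdvantage.AdviceFreeQNC0.PredHard
import HarnessLib

/-!
# Cell qa-qnc0 (rung F-Q2-odd, `p = 3`): THEOREM A `BShotDWB3` — the B-shot two-thirds law, PROVED

Planner qa-qnc0-p1 g16, `ROUND-15.md` §2–§3 (THEOREM A): every bell vector of `𝔽₃`-polynomials of degree
`≤ (log₂ N)^C` ringing `≤ B` bells on every odd-class pattern, `B⁴ ≤ N`, wins the ring game on at most
`(2/3 + ε)·2^{N−1}` odd-class patterns.  Assembly over the line's files: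

* `odd_Sx` — the structured pattern with the admissible sign is in the odd class, so the transported bells ring `≤ B₀`
  times there (`card_wtil_psi_Sx_le`, `B₀ = ⌊N^{1/4}⌋`);
* `sum_Vsum_win_le` — structured side for the WIN indicator of the trimmed bells (`StructuredWin.card_win_structured_le`
  + identity (T) + payoff identity `winOdd_wtil_psi`); `card_win_wtil_le` — with the TRUE side `sum_odd_le`:
  `3·#{x odd : WIN_{w̃}} ≤ 2^n(1+4/2^L)^{m+1}(2 + 4/2^K + 18·2^K·(2B₀ΔL)/√ℓ)`;
* `exists_window` — window removal (ROUND-15 §3.1): among `Q` disjoint windows one has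
  `Q·#{x odd : an inner bell rings} ≤ B₀·2^{n+1}`;
* **`bShotDWB3 : BShotDWB3`** — parameters `L = log₂N`, `2^K ≥ 16/ε`, `A > 144·2^K·B₀/ε`, `ℓ = (AΔL)²`,
  `W = (⌊K(6ℓ+1)/L⌋ + 4)·L ≈ B₀²·polylog`, `Q = ⌊n/W⌋`; all growth conditions are `polylog(N)·B₀³ ≤ N`.

WHAT THIS IS NOT: the dense regime (`DenseResidual3`) and `RingHardOdd 3` stay OPEN; separation NOT moved.
-/

noncomputable section

namespace Summit.QuantumAdvantage.AdviceFreeQNC0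

namespace DWalk

open Finset Equiv
open Literature.Computability.MetaComplexity Literature.Computability.MetaComplexity.Smolensky

section BShot

variable {n a L m K ℓ Lf : ℕ}

/-! ### The structured pattern with the admissible sign is odd -/

/-- With the admissible sign `εb y`, the structured pattern is in the odd class. -/
theorem odd_Sx (haW : a + (m + 1) * L ≤ n) (hW : (m + 1) * L = K * (6 * ℓ + 1) + Lf) {fb : Fin Lf → Bool}
    {τ : ZMod 3} (y : Fin (n + 1) → Bool) (hfb : fb ∈ fib (1 : ZMod 3) Lf (affP (εb a L m y) τ))
    (c : Fin (K * ℓ) → Bool) :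
    (univ.filter fun j : Fin (n + 1) => Sx a L m K ℓ fb y c j = false).card % 2 = 1 := by
  have hrepr : Sx a L m K ℓ fb y c = glue a L m y (unblk L m (wblk L m (swin L m K ℓ fb c))) := by
    unfold Sx; rw [unblk_wblk]
  set B := wblk L m (swin L m K ℓ fb c) with hB
  have hBmem : B ∈ BlkSet L m (1 : ZMod 3) (fun j => blockPerm 1 (B j)) := mem_BlkSet.2 fun _ => rfl
  rw [hrepr, odd_glue_unblk_iff (kappaConst_one a L m) haW y hBmem]
  have hP : Fin.partialProd (fun j => blockPerm (1 : ZMod 3) (B j)) (Fin.last (m + 1)) =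
      Pwin a L m 1 (Sx a L m K ℓ fb y c) := by
    unfold Pwin; congr 1; funext j; rw [hrepr, Gblk_glue_unblk haW]
  rw [hP, Pwin_Sx (kappaConst_one a L m) haW hW hfb y c, sgnP_affP]
  exact (admS_yt_iff y _).2 rfl

/-- Hence the transported trimmed bells ring at most `B₀` times at every structured input, if `w` is `B₀`-shot on
the odd class. -/
theorem card_wtil_psi_Sx_le (haW : a + (m + 1) * L ≤ n) (hW : (m + 1) * L = K * (6 * ℓ + 1) + Lf)
    {fb : Fin Lf → Bool} {τ : ZMod 3} (y : Fin (n + 1) → Bool)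
    (hfb : fb ∈ fib (1 : ZMod 3) Lf (affP (εb a L m y) τ)) {w : Fin (n + 1) → CubeFn (ZMod 3) (n + 1)} {B₀ : ℕ}
    (hshot : ∀ x : Fin (n + 1) → Bool, (univ.filter fun j : Fin (n + 1) => x j = false).card % 2 = 1 →
      (univ.filter fun k : Fin (n + 1) => w k x = 1).card ≤ B₀)
    (r : Rand L m (1 : ZMod 3)) (c : Fin (K * ℓ) → Bool) :
    (univ.filter fun k : Fin (n + 1) => wtil a L m w k (psi a L m 1 r (Sx a L m K ℓ fb y c)) = 1).card ≤ B₀ := by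
  refine le_trans (Finset.card_le_card fun k hk => ?_)
    (hshot _ ((odd_psi_iff (kappaConst_one a L m) haW r _).2 (odd_Sx haW hW y hfb c)))
  rw [mem_filter] at hk ⊢
  exact ⟨mem_univ _, (wtil_eq_one_iff.1 hk.2).2⟩

/-! ### Structured side for the WIN indicator -/

/-- **Structured side for WIN**: `Σ_t V c_W y (affP (εb y) t) ≤ 6^m·(2 + 4/2^K + 18·2^K·(2B₀ΔL)/√ℓ)`. -/
theorem sum_Vsum_win_le (haW : a + (m + 1) * L ≤ n) (hL : 3 ≤ L) (hℓ : 1 ≤ ℓ) (hLf : 3 ≤ Lf)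
    (hW : (m + 1) * L = K * (6 * ℓ + 1) + Lf) (y : Fin (n + 1) → Bool) {Δ : ℕ}
    {w : Fin (n + 1) → CubeFn (ZMod 3) (n + 1)} (hw : ∀ k, w k ∈ lowDeg (ZMod 3) (n + 1) Δ) {B₀ : ℕ}
    (hshot : ∀ x : Fin (n + 1) → Bool, (univ.filter fun j : Fin (n + 1) => x j = false).card % 2 = 1 →
      (univ.filter fun k : Fin (n + 1) => w k x = 1).card ≤ B₀) :
    ∑ t : ZMod 3, Vsum a L m 1 (fun x => if WinOdd (wtil a L m w) x then (1 : ℝ) else 0) y (affP (εb a L m y) t) ≤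
      (6 : ℝ) ^ m * (2 + 4 / (2 : ℝ) ^ K + 18 * (2 : ℝ) ^ K * ((B₀ * (2 * (Δ * L)) : ℕ) : ℝ) / Real.sqrt ℓ) := by
  have h10 : (1 : ZMod 3) ≠ 0 := one_ne_zero
  set b := εb a L m y with hb
  set c₁ : (Fin (n + 1) → Bool) → ℝ := fun x => if WinOdd (wtil a L m w) x then (1 : ℝ) else 0 with hc₁
  set Bd : ℝ := (2 : ℝ) ^ (K * ℓ) *
    (2 / 3 + 4 / 3 / (2 : ℝ) ^ K + 6 * (2 : ℝ) ^ K * ((B₀ * (2 * (Δ * L)) : ℕ) : ℝ) / Real.sqrt ℓ) with hBd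
  have hT : (0 : ℝ) < Fintype.card (Tbl L m (1 : ZMod 3)) := by exact_mod_cast card_Tbl_pos h10 hL
  have hτ : ∀ τ : ZMod 3,
      (∑ c : Fin (K * ℓ) → Bool, Vsum a L m 1 c₁ y (Pwin a L m 1 (Sx a L m K ℓ (fbOf h10 hLf b τ) y c))) *
        Fintype.card (Tbl L m (1 : ZMod 3)) ≤ (Fintype.card (Rand L m (1 : ZMod 3)) : ℝ) * Bd := by
    intro τ
    rw [Finset.sum_mul]
    have hx : ∀ c : Fin (K * ℓ) → Bool,
        Vsum a L m 1 c₁ y (Pwin a L m 1 (Sx a L m K ℓ (fbOf h10 hLf b τ) y c)) * Fintype.card (Tbl L m (1 : ZMod 3)) =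
        ∑ r : Rand L m (1 : ZMod 3), c₁ (psi a L m 1 r (Sx a L m K ℓ (fbOf h10 hLf b τ) y c)) := by
      intro c; rw [sum_psi_eq h10 hL, mul_comm]; unfold Sx; rw [Vsum_glue]
    simp only [hx]
    rw [Finset.sum_comm]
    calc ∑ r : Rand L m (1 : ZMod 3), ∑ c : Fin (K * ℓ) → Bool, c₁ (psi a L m 1 r (Sx a L m K ℓ (fbOf h10 hLf b τ) y c))
        ≤ ∑ _r : Rand L m (1 : ZMod 3), Bd := Finset.sum_le_sum fun r _ => by
          rw [hc₁]; dsimp only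
          simp only [winOdd_wtil_psi haW r w]
          rw [← natCast_card_filter]
          exact card_win_structured_le haW (by omega) hℓ hW (fbOf_mem h10 hLf b τ) y hw r
            (card_wtil_psi_Sx_le haW hW y (fbOf_mem h10 hLf b τ) hshot r)
      _ = (Fintype.card (Rand L m (1 : ZMod 3)) : ℝ) * Bd := by rw [sum_const, card_univ, nsmul_eq_mul]
  have hsum : ∑ τ : ZMod 3, ∑ c : Fin (K * ℓ) → Bool,
      Vsum a L m 1 c₁ y (Pwin a L m 1 (Sx a L m K ℓ (fbOf h10 hLf b τ) y c)) =
      (2 : ℝ) ^ (K * ℓ) * ∑ t : ZMod 3, Vsum a L m 1 c₁ y (affP b t) := by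
    rw [Finset.sum_comm]
    have : ∀ c : Fin (K * ℓ) → Bool, ∑ τ : ZMod 3,
        Vsum a L m 1 c₁ y (Pwin a L m 1 (Sx a L m K ℓ (fbOf h10 hLf b τ) y c)) = ∑ t : ZMod 3, Vsum a L m 1 c₁ y (affP b t) := by
      intro c
      simp only [Pwin_Sx (kappaConst_one a L m) haW hW (fbOf_mem h10 hLf b _) y c]
      exact Equiv.sum_comp (Equiv.addLeft ((1 : ZMod 3) * ∑ j ∈ range K, gsign ℓ (cbOf K ℓ c j)))
        (fun t => Vsum a L m 1 c₁ y (affP b t))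
    simp only [this, sum_const, card_univ, Fintype.card_fun, Fintype.card_bool, Fintype.card_fin, nsmul_eq_mul]
    push_cast; ring
  have htot := Finset.sum_le_sum fun τ (_ : τ ∈ (univ : Finset (ZMod 3))) => hτ τ
  rw [← Finset.sum_mul, hsum, sum_const, card_univ, ZMod.card, nsmul_eq_mul, card_Rand] at htot
  push_cast at htot
  have h2 : (0 : ℝ) < (2 : ℝ) ^ (K * ℓ) := by positivity
  have key : ∑ t : ZMod 3, Vsum a L m 1 c₁ y (affP b t) ≤ 3 * (6 : ℝ) ^ m * Bd / (2 : ℝ) ^ (K * ℓ) := by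
    rw [le_div_iff₀ h2]; nlinarith
  refine le_trans key (le_of_eq ?_)
  rw [hBd]; field_simp; ring

/-- **Main count for the trimmed bells**:
`3·#{x odd : WIN_{w̃}(x)} ≤ 2^n·(1 + 4/2^L)^{m+1}·(2 + 4/2^K + 18·2^K·(2B₀ΔL)/√ℓ)`. -/
theorem card_win_wtil_le (haW : a + (m + 1) * L ≤ n) (hL : 3 ≤ L) (hℓ : 1 ≤ ℓ) (hLf : 3 ≤ Lf)
    (hW : (m + 1) * L = K * (6 * ℓ + 1) + Lf) {Δ : ℕ} {w : Fin (n + 1) → CubeFn (ZMod 3) (n + 1)}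
    (hw : ∀ k, w k ∈ lowDeg (ZMod 3) (n + 1) Δ) {B₀ : ℕ}
    (hshot : ∀ x : Fin (n + 1) → Bool, (univ.filter fun j : Fin (n + 1) => x j = false).card % 2 = 1 →
      (univ.filter fun k : Fin (n + 1) => w k x = 1).card ≤ B₀) :
    3 * ((univ.filter fun x : Fin (n + 1) → Bool =>
        (univ.filter fun j : Fin (n + 1) => x j = false).card % 2 = 1 ∧ WinOdd (wtil a L m w) x).card : ℝ) ≤
      (2 : ℝ) ^ n * (1 + 4 / (2 : ℝ) ^ L) ^ (m + 1) *
        (2 + 4 / (2 : ℝ) ^ K + 18 * (2 : ℝ) ^ K * ((B₀ * (2 * (Δ * L)) : ℕ) : ℝ) / Real.sqrt ℓ) := by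
  set c₁ : (Fin (n + 1) → Bool) → ℝ := fun x => if WinOdd (wtil a L m w) x then (1 : ℝ) else 0 with hc₁
  set E : ℝ := 2 + 4 / (2 : ℝ) ^ K + 18 * (2 : ℝ) ^ K * ((B₀ * (2 * (Δ * L)) : ℕ) : ℝ) / Real.sqrt ℓ with hE
  have hc0 : ∀ x, 0 ≤ c₁ x := fun x => by rw [hc₁]; dsimp only; split_ifs <;> norm_num
  have hcount : ((univ.filter fun x : Fin (n + 1) → Bool =>
      (univ.filter fun j : Fin (n + 1) => x j = false).card % 2 = 1 ∧ WinOdd (wtil a L m w) x).card : ℝ) =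
      ∑ x : Fin (n + 1) → Bool, (if (univ.filter fun j : Fin (n + 1) => x j = false).card % 2 = 1 then c₁ x else 0) := by
    rw [natCast_card_filter]
    refine Finset.sum_congr rfl fun x _ => ?_
    by_cases h1 : (univ.filter fun j : Fin (n + 1) => x j = false).card % 2 = 1 <;> simp [h1, hc₁]
  rw [hcount]
  have h1 := sum_odd_le (one_ne_zero) (kappaConst_one a L m) haW hL c₁ hc0
  have h3 : ∑ y ∈ Yset a L m, ∑ t : ZMod 3, Vsum a L m 1 c₁ y (affP (εb a L m y) t) ≤
      ((Yset (n := n) a L m).card : ℝ) * ((6 : ℝ) ^ m * E) := by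
    calc _ ≤ ∑ _y ∈ Yset a L m, (6 : ℝ) ^ m * E :=
          Finset.sum_le_sum fun y _ => sum_Vsum_win_le haW hL hℓ hLf hW y hw hshot
      _ = _ := by rw [sum_const, nsmul_eq_mul]
  have hY := card_Yset (n := n) (a := a) (L := L) (m := m) haW
  have hfm : (0 : ℝ) ≤ (((2 : ℝ) ^ L + 4) / 6) ^ (m + 1) := by positivity
  have h4 := le_trans h1 (mul_le_mul_of_nonneg_left h3 hfm)
  have hpowW : (2 : ℝ) ^ ((m + 1) * L) = ((2 : ℝ) ^ L) ^ (m + 1) := by rw [← pow_mul, Nat.mul_comm]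
  have hYval : ((Yset (n := n) a L m).card : ℝ) = (2 : ℝ) ^ (n + 1) / ((2 : ℝ) ^ L) ^ (m + 1) := by
    rw [← hpowW, eq_div_iff (by positivity)]; exact hY
  have key : (((2 : ℝ) ^ L + 4) / 6) ^ (m + 1) * (((Yset (n := n) a L m).card : ℝ) * ((6 : ℝ) ^ m * E)) =
      (2 : ℝ) ^ n * (1 + 4 / (2 : ℝ) ^ L) ^ (m + 1) * E / 3 := by
    rw [hYval]
    have e1 : (((2 : ℝ) ^ L + 4) / 6) ^ (m + 1) = ((2 : ℝ) ^ L) ^ (m + 1) * (1 + 4 / (2 : ℝ) ^ L) ^ (m + 1) /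
        ((6 : ℝ) ^ m * 6) := by
      rw [← pow_succ, ← mul_pow, ← div_pow]; congr 1; field_simp
    rw [e1, pow_succ (2 : ℝ) n]; field_simp; ring
  rw [key] at h4
  linarith

/-! ### Window removal -/

/-- **Some window is quiet**: if every odd pattern rings at most `B₀` bells, then among the `Q` windows
`[iW, iW + W)`, `i < Q`, one has `Q·#{x odd : a bell at an inner cut rings} ≤ B₀·2^{n+1}`. -/
theorem exists_window {W Q : ℕ} (hQ : 1 ≤ Q) (w : Fin (n + 1) → CubeFn (ZMod 3) (n + 1)) {B₀ : ℕ}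
    (hshot : ∀ x : Fin (n + 1) → Bool, (univ.filter fun j : Fin (n + 1) => x j = false).card % 2 = 1 →
      (univ.filter fun k : Fin (n + 1) => w k x = 1).card ≤ B₀) :
    ∃ i, i < Q ∧ Q * (univ.filter fun x : Fin (n + 1) → Bool =>
      (univ.filter fun j : Fin (n + 1) => x j = false).card % 2 = 1 ∧
        ∃ k : Fin (n + 1), (i * W < k.val ∧ k.val < i * W + W) ∧ w k x = 1).card ≤ B₀ * 2 ^ (n + 1) := by
  classical
  set cnt : ℕ → ℕ := fun i => (univ.filter fun x : Fin (n + 1) → Bool =>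
      (univ.filter fun j : Fin (n + 1) => x j = false).card % 2 = 1 ∧
        ∃ k : Fin (n + 1), (i * W < k.val ∧ k.val < i * W + W) ∧ w k x = 1).card with hcnt
  -- total over the windows
  have htot : ∑ i ∈ range Q, cnt i ≤ B₀ * 2 ^ (n + 1) := by
    have h1 : ∑ i ∈ range Q, cnt i = ∑ x : Fin (n + 1) → Bool, ((range Q).filter fun i =>
        (univ.filter fun j : Fin (n + 1) => x j = false).card % 2 = 1 ∧
          ∃ k : Fin (n + 1), (i * W < k.val ∧ k.val < i * W + W) ∧ w k x = 1).card := by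
      simp only [hcnt, Finset.card_filter]
      rw [Finset.sum_comm]
    rw [h1]
    calc ∑ x : Fin (n + 1) → Bool, ((range Q).filter fun i =>
          (univ.filter fun j : Fin (n + 1) => x j = false).card % 2 = 1 ∧
            ∃ k : Fin (n + 1), (i * W < k.val ∧ k.val < i * W + W) ∧ w k x = 1).card
        ≤ ∑ _x : Fin (n + 1) → Bool, B₀ := Finset.sum_le_sum fun x _ => ?_
      _ = B₀ * 2 ^ (n + 1) := by
          rw [sum_const, card_univ, Fintype.card_fun, Fintype.card_bool, Fintype.card_fin, smul_eq_mul, mul_comm]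
    by_cases hodd : (univ.filter fun j : Fin (n + 1) => x j = false).card % 2 = 1
    · -- each such window contains a ringing bell, and the inner intervals are disjoint
      set f : ℕ → Finset (Fin (n + 1)) := fun i =>
        univ.filter fun k : Fin (n + 1) => (i * W < k.val ∧ k.val < i * W + W) ∧ w k x = 1 with hf
      set S := (range Q).filter fun i =>
        (univ.filter fun j : Fin (n + 1) => x j = false).card % 2 = 1 ∧
          ∃ k : Fin (n + 1), (i * W < k.val ∧ k.val < i * W + W) ∧ w k x = 1 with hS
      have hdisj : (S : Set ℕ).PairwiseDisjoint f := by
        intro i _ j _ hij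
        refine Finset.disjoint_filter.2 ?_
        rintro k _ ⟨⟨h1, h2⟩, _⟩ ⟨⟨h3, h4⟩, _⟩
        rcases Nat.lt_or_gt_of_ne hij with h | h
        · have : (i + 1) * W ≤ j * W := Nat.mul_le_mul_right _ h
          rw [Nat.add_mul, one_mul] at this; omega
        · have : (j + 1) * W ≤ i * W := Nat.mul_le_mul_right _ h
          rw [Nat.add_mul, one_mul] at this; omega
      have hne : ∀ i ∈ S, (f i).Nonempty := by
        intro i hi
        rw [hS, mem_filter] at hi
        obtain ⟨k, hk, hk1⟩ := hi.2.2
        exact ⟨k, mem_filter.2 ⟨mem_univ _, hk, hk1⟩⟩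
      calc S.card ≤ (S.biUnion f).card := Finset.card_le_card_biUnion hdisj hne
        _ ≤ (univ.filter fun k : Fin (n + 1) => w k x = 1).card := by
            refine Finset.card_le_card fun k hk => ?_
            rw [Finset.mem_biUnion] at hk
            obtain ⟨i, _, hk⟩ := hk
            rw [mem_filter] at hk ⊢
            exact ⟨mem_univ _, hk.2.2⟩
        _ ≤ B₀ := hshot x hodd
    · rw [Finset.filter_false_of_mem (fun i _ => by simp [hodd]), card_empty]; exact Nat.zero_le _
  -- pick the minimum
  obtain ⟨i, hi, hle⟩ := Finset.exists_le_of_sum_le (s := range Q) ⟨0, by simp; omega⟩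
    (f := fun i => Q * cnt i) (g := fun _ => ∑ j ∈ range Q, cnt j)
    (by rw [← Finset.mul_sum, sum_const, card_range, smul_eq_mul])
  exact ⟨i, Finset.mem_range.1 hi, le_trans hle htot⟩

end BShot

end DWalk

end Summit.QuantumAdvantage.AdviceFreeQNC0

end
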